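import Literature.Combinatorics.Optimization.SubgroupEquivariantPsdStructure
import Literature.Combinatorics.Optimization.MatchingEquivariantPsdLowerBound
import Literature.Combinatorics.Optimization.SDPFormulationMatchingEquivariant
import HarnessLib

/-!
# Subgroup-equivariant psd factorizations of the matching polytope have size `2^{Ω(n)}`;
# Braun et al.'s Theorem 4.10 (no small symmetric SDP for matching) discharged

Braun–Brown-Cohen–Huq–Pokutta–Raghavendra–Roy–Weitz–Zink, *The matching problem has no small symmetric
SDP* (arXiv:1504.00703; Math. Program. 165 (2017)), **Theorem 4.10** (p. 9): there is an absolute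
`α > 0` such that for all even `n` and `0 ≤ ε < 1` every `A_n`-coordinate-symmetric SDP extended
formulation approximating the perfect matching problem within `1 − ε/(n−1)` has size `≥ 2^{αn}`. The
tree carried this as the NAMED FACT `BraunEtAl2016_symmetricSDP_matching` (`SymmetricSDPMatching.lean`);
this file PROVES it: `BraunEtAl2016_symmetricSDP_matching_holds`.

The proof is the printed one (pp. 9–10) in the Fawzi–Saunderson–Parrilo generality typed by the cell
pnp-psdrank (planner p2, `HOME/pnp-psdrank-p2/Sketch-v5-R2full-PROVED.lean`, ported verbatim; the
`𝔖ₙ`/`ε = 0` special case is `matchingEquivariantPsdBound`, `MatchingEquivariantPsdLowerBound.lean`):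

* `oddCutRestrictionShift` (Lemma 3; §4.5, p. 10): an SOS certificate of `x(δ(U)) − 1 + c` (`c < 1`) from
  the matching constraints of `K_n` restricts along the mirror substitution (tree:
  `OddCut.exists_mirrorData`) to an SOS refutation of `MOD2_{|U|}` of the same degree (divide by `1 − c`);
* Theorem A `sos_of_subgroupEquivariantPsdFactorization` (+ affine form): a `G`-equivariant psd
  factorization of size `d` of the `ε`-shifted odd-cut slack with `[𝔖ₙ:G]·d² < 2^k`, `4k+2 ≤ n`, writes
  every shifted odd-cut slack as a sum of squares of functions of degree `≤ k` — FSP structure theorem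
  (`subgroupStructureSq`) + index span (`indexSpan`) + "small invariant subspaces are low-degree"
  (`invariantSubspaceLowDegree`, `MatchingInvariantSubspaces.lean` = Braun et al. Prop. 4.3 in subspace
  form);
* Theorem B `thetaRank_linear_shift`: degree-`k` SOS representations of the shifted slacks (`ε < 1`)
  force `k ≥ c·n` — Thm. 4.9 (`Mod2.matchingEffectiveDerivationV`), Lemma 3, Grigoriev
  (`Grigoriev2001_mod2Degree_holds`);
* the counting endgame `two_pow_le_of_sos` (`k := ⌊log₂([𝔖ₙ:G]·d²)⌋ + 1`, `α := min (1/16) (c/6)`) and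
  **R2-full** `matchingSubgroupEquivariantPsdBound`: uniformly in `0 ≤ ε < 1`, for even `n ≥ n₀` and
  EVERY subgroup `G ≤ 𝔖ₙ` of index `< 2^{αn}` (e.g. `A_n`), every `G`-equivariant psd factorization
  (arbitrary real `ρ`) of the `ε`-shifted odd-cut slack has size `≥ 2^{αn}` (+ affine form
  `subgroupEquivariantPsdBoundAff`);
* the bridge (Lemma 2.3 p. 5 + §4 p. 7: `C̃(f_{E[U]}) − f_{E[U]}(M) = ½(|δ(U) ∩ M| − 1 + ε)`, tree
  `two_mul_pmSlack_inner_eq` / `SDPFormulation.exists_posSemidef_slack`): an `ε`-approximate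
  `A_n`-coordinate-symmetric SDP formulation of size `d` IS an affine `A_n`-equivariant psd factorization
  of size `d` (matching side `X^M`, representation `σ ↦ P_{ρ(σ)⁻¹}`, odd side `2U^{f_{E[U]}}`, constant
  `2μ_f`), and `[𝔖ₙ : A_n] = 2 < 2^{αn}`.

Stature (cell line 1): this is the printed SYMMETRIC theorem, formalised and modestly generalised
(arbitrary real representation of any small-index subgroup); it says nothing about the general psd rank
of the matching polytope (the open Fawzi–Gouveia–Parrilo–Robinson–Thomas question). No statement of
`MatchingEquivariantPsdLowerBound.lean` is restated here.

## References

* G. Braun, J. Brown-Cohen, A. Huq, S. Pokutta, P. Raghavendra, A. Roy, B. Weitz, D. Zink,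
  arXiv:1504.00703, Def. 2.2 / Lemma 2.3 (p. 5), §4 (p. 7), Thm. 4.9 (p. 9), Thm. 4.10 (p. 9, proof
  pp. 9–10), Thm. 4.11 (p. 10). [BraunEtAl2016]
* H. Fawzi, J. Saunderson, P. A. Parrilo, arXiv:1312.6662, Thm. 1 (p. 7), Thm. 4 (p. 10). [FawziSaundersonParrilo2013]
* D. Grigoriev, Theoret. Comput. Sci. 259 (2001) 613–622, Cor. 2. [Grigoriev2001TCS]
-/

noncomputable section

open Finset Matrix

namespace Literature.Combinatorics.Optimization

open Literature.Barriers.PneNP Literature.Computability.Complexity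

/-! ### Lemma 3 — restriction of shifted odd-cut certificates (Braun et al. §4.5 with `ε < 1`) -/

section OddCutRestrictionShift

open MvPolynomial

/-- Rescaling an SOS certificate by a positive constant (over `ℝ`: `a • q² = (√a q)²`).
[cite: BraunEtAl2016, §4.5 (p. 10, "−(1−ε)/2 ≅ Σ g² + μ_f")] -/
theorem hasSOSCertificate_smul_of_pos {ι σ : Type*} [Fintype ι] {S : ι → MvPolynomial σ ℝ}
    {p : MvPolynomial σ ℝ} {d : ℕ} (h : HasSOSCertificate S p d) {a : ℝ} (ha : 0 < a) :
    HasSOSCertificate S (a • p) d := by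
  obtain ⟨m, q, g, hq, hg, hsum⟩ := h
  refine ⟨m, fun l => Real.sqrt a • q l, fun e => a • g e, ?_, ?_, ?_⟩
  · intro l
    exact (totalDegree_smul_le _ _).trans (hq l)
  · intro e
    rw [smul_mul_assoc]
    exact (totalDegree_smul_le _ _).trans (hg e)
  · have hsq : ∀ l, (Real.sqrt a • q l) * (Real.sqrt a • q l) = a • (q l * q l) := by
      intro l
      rw [smul_mul_smul_comm, Real.mul_self_sqrt ha.le]
    simp_rw [hsq, smul_mul_assoc, ← Finset.smul_sum, ← smul_add, hsum]

/-- **Shifted restriction (Lemma 3 of the cell's R2-full; `ε`-variant of `oddCutRestriction`).** For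
even `n`, an odd `U` with `2|U| ≤ n`, `c < 1` and an SOS certificate of `x(δ(U)) − 1 + c ≥ 0` of degree
`d` from the perfect-matching constraints of `K_n`, the mirror substitution of Braun et al. §4.5
(`x_{2m+1,2m+2} ↦ 1`, `x_{u+m,v+m} ↦ x_{uv}`, all other `x_{uv} ↦ 0`) yields the identity
`−1 + c = Σ q² + Σ g·(MOD2)` on `K_{|U|}`, and dividing by `1 − c > 0` an SOS refutation of `MOD2_{|U|}` of
degree `d`. Statement = the cell's typed `OddCutRestrictionShift` (HOME/pnp-psdrank-p2/Sketch-v4-R2full.lean,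
verbatim). [cite: BraunEtAl2016, Thm. 4.10 (proof, §4.5, p. 10)] -/
theorem oddCutRestrictionShift :
    ∀ n : ℕ, Even n → ∀ U : Finset (Fin n), Odd U.card → 2 * U.card ≤ n → ∀ c : ℝ, c < 1 → ∀ d : ℕ,
      HasSOSCertificate (Mod2.system n) (cutPoly U + MvPolynomial.C c) d →
        HasSOSRefutation (Mod2.system U.card) d := by
  intro n hn U _hU h2 c hc d h
  obtain ⟨D, hD⟩ := OddCut.exists_mirrorData hn U h2
  have h1 : HasSOSCertificate (Mod2.system U.card) (aeval D.subst (cutPoly U + C c)) d :=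
    h.map_aeval_of_totalDegree_le_one D.subst D.totalDegree_subst_le_one D.aeval_system
  rw [map_add, D.aeval_cutPoly hD, aeval_C, MvPolynomial.algebraMap_eq] at h1
  have hpos : 0 < 1 / (1 - c) := one_div_pos.mpr (sub_pos.mpr hc)
  have h2 := hasSOSCertificate_smul_of_pos h1 hpos
  have hid : (1 / (1 - c)) • (-1 + C c : MvPolynomial (KnEdge U.card) ℝ) = -1 := by
    have hc1 : (1 - c) ≠ 0 := (sub_pos.mpr hc).ne'
    rw [show (-1 + C c : MvPolynomial (KnEdge U.card) ℝ) = C (c - 1) by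
      rw [map_sub, map_one]; ring]
    rw [← C_mul', ← map_mul, show (1 / (1 - c)) * (c - 1) = -1 by field_simp; ring]
    simp
  rw [hid] at h2
  exact h2

end OddCutRestrictionShift

/-! ### Theorem A — small `G`-equivariant factorizations give low-degree sums of squares -/

/-- **Theorem A (subgroup form).** For even `n`, `4k + 2 ≤ n` and `[𝔖ₙ : G] · d² < 2^k`, a
`G`-equivariant psd factorization of size `d` of the `ε`-shifted odd-cut slack makes every shifted
odd-cut slack `pmSlack U · + ε` (`U` odd) a sum of squares of functions of degree `≤ k`
(structure theorem → index span → small invariant subspaces are low-degree).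
[cite: FawziSaundersonParrilo2013, Thm. 1 (p. 7)] [cite: BraunEtAl2016, Thm. 4.10 (proof, p. 10, "by prop:matching-junta every h ∈ 𝓗 … degree less than k/2")] -/
theorem sos_of_subgroupEquivariantPsdFactorization (n k d : ℕ) (G : Subgroup (Equiv.Perm (Fin n)))
    (ε : ℝ) (hn : Even n) (hk : 4 * k + 2 ≤ n) (hd : G.index * d ^ 2 < 2 ^ k)
    (hfac : HasSubgroupEquivariantPsdFactorization n d G ε) :
    ∀ U : Finset (Fin n), Odd U.card → ∃ (s : ℕ) (g : Fin s → (PMSol n → ℝ)),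
      (∀ j, g j ∈ polLE n k) ∧ ∀ M : PMSol n, pmSlack U M.1 + ε = ∑ j, (g j M) ^ 2 := by
  intro U hU
  obtain ⟨ρ, A, B, hρAB⟩ := hfac
  obtain ⟨V, hVinv, hVdim, hVsq⟩ := subgroupStructureSq n d G ε ρ A B hρAB
  obtain ⟨V', hV'inv, hVV', hV'dim⟩ := indexSpan n G V hVinv
  have hlt : Module.finrank ℝ V' < 2 ^ k :=
    lt_of_le_of_lt (hV'dim.trans (Nat.mul_le_mul_left _ hVdim)) hd
  have hV'le : V' ≤ polLE n k := invariantSubspaceLowDegree n k hn hk V' hV'inv hlt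
  obtain ⟨s, g, hgV, hgsum⟩ := hVsq U hU
  exact ⟨s, g, fun j => hV'le (hVV' (hgV j)), hgsum⟩

/-- Constant functions on the perfect matchings have degree `0 ≤ k` (the empty monomial).
[cite: BraunEtAl2016, Lemma 2.3 (p. 5, the constant μ_f)] -/
theorem const_mem_polLE (n k : ℕ) (c : ℝ) : (fun _ : PMSol n => c) ∈ polLE n k := by
  have h1 : monomialFn (∅ : Finset (Sym2 (Fin n))) = fun _ : PMSol n => (1 : ℝ) := by
    funext M
    simp [monomialFn_apply]
  have h2 : (fun _ : PMSol n => c) = c • monomialFn (∅ : Finset (Sym2 (Fin n))) := by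
    rw [h1]
    funext M
    simp
  rw [h2]
  exact Submodule.smul_mem _ _ (Submodule.subset_span ⟨∅, by simp, rfl⟩)

/-- **Theorem A (affine subgroup form)**: as `sos_of_subgroupEquivariantPsdFactorization` for an affine
factorization `pmSlack U M + ε = tr(A(M) B(U)) + μ(U)`; the constant `μ(U) ≥ 0` is absorbed as the square
of the constant function `√μ(U) ∈ Pol_{≤0}`.
[cite: BraunEtAl2016, Lemma 2.3 (p. 5) and Thm. 4.10 (proof, p. 10, "f ≅ Σ g² + μ_f")] -/
theorem sos_of_subgroupEquivariantPsdFactorizationAff (n k d : ℕ) (G : Subgroup (Equiv.Perm (Fin n)))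
    (ε : ℝ) (ρ : G →* GL (Fin d) ℝ) (A : Finset (Sym2 (Fin n)) → Matrix (Fin d) (Fin d) ℝ)
    (B : Finset (Fin n) → Matrix (Fin d) (Fin d) ℝ) (μ : Finset (Fin n) → ℝ) (hn : Even n)
    (hk : 4 * k + 2 ≤ n) (hd : G.index * d ^ 2 < 2 ^ k)
    (h : IsSubgroupEquivariantPsdFactorizationAff n d G ε ρ A B μ) :
    ∀ U : Finset (Fin n), Odd U.card → ∃ (s : ℕ) (g : Fin s → (PMSol n → ℝ)),
      (∀ j, g j ∈ polLE n k) ∧ ∀ M : PMSol n, pmSlack U M.1 + ε = ∑ j, (g j M) ^ 2 := by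
  intro U hU
  obtain ⟨V, hVinv, hVdim, hVsq⟩ := subgroupStructureSqAff n d G ε ρ A B μ h
  obtain ⟨V', hV'inv, hVV', hV'dim⟩ := indexSpan n G V hVinv
  have hlt : Module.finrank ℝ V' < 2 ^ k :=
    lt_of_le_of_lt (hV'dim.trans (Nat.mul_le_mul_left _ hVdim)) hd
  have hV'le : V' ≤ polLE n k := invariantSubspaceLowDegree n k hn hk V' hV'inv hlt
  obtain ⟨s, g, hgV, hgsum⟩ := hVsq U hU
  refine ⟨s + 1, Fin.cons (fun _ => Real.sqrt (μ U)) g, fun j => ?_, fun M => ?_⟩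
  · refine Fin.cases ?_ (fun i => ?_) j
    · rw [Fin.cons_zero]
      exact const_mem_polLE n k _
    · rw [Fin.cons_succ]
      exact hV'le (hVV' (hgV i))
  · rw [Fin.sum_univ_succ, Fin.cons_zero, hgsum M, Real.sq_sqrt (h.2.2.1 U hU), add_comm]
    simp only [Fin.cons_succ]

/-! ### Theorem B — degree-`k` sums of squares for the shifted slacks force `k ≥ c·n` -/

/-- **Theorem B (shifted form of `thetaRank_linear`).** There are `c > 0` and `n₀` such that for even
`n ≥ n₀`, every `ε < 1` and every `k`: if every `ε`-shifted odd-cut slack of `K_n` is a sum of squares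
of functions of degree `≤ k`, then `c·n ≤ k`. Proof as printed: pick an odd `U` with `|U| ∈ {n/2−1, n/2}`,
lift the squares to polynomials (`polLELift`), derive the defect from the matching ideal in degree
`2k + 1` (Thm. 4.9 = `Mod2.matchingEffectiveDerivationV`), restrict to `K_{|U|}` and divide by `1 − ε`
(`oddCutRestrictionShift`), and apply Grigoriev (`Grigoriev2001_mod2Degree_holds`).
[cite: BraunEtAl2016, Thm. 4.9 (p. 9) and Thm. 4.10 (proof, pp. 9–10)] [cite: Grigoriev2001TCS, Cor. 2] -/
theorem thetaRank_linear_shift :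
    ∃ c : ℝ, 0 < c ∧ ∃ n₀ : ℕ, ∀ n : ℕ, n₀ ≤ n → Even n → ∀ ε : ℝ, ε < 1 → ∀ k : ℕ,
      (∀ U : Finset (Fin n), Odd U.card → ∃ (s : ℕ) (g : Fin s → (PMSol n → ℝ)),
        (∀ j, g j ∈ polLE n k) ∧ ∀ M : PMSol n, pmSlack U M.1 + ε = ∑ j, (g j M) ^ 2) → c * n ≤ k := by
  classical
  -- for even `n ≥ 2` there is an odd `m` with `n - 2 ≤ 2m ≤ n`
  have exists_odd_half : ∀ {n : ℕ}, Even n → 2 ≤ n → ∃ m : ℕ, Odd m ∧ 2 * m ≤ n ∧ n ≤ 2 * m + 2 := by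
    intro n hn h2
    obtain ⟨a, rfl⟩ := hn
    rcases Nat.even_or_odd a with ha | ha
    · obtain ⟨b, rfl⟩ := ha
      exact ⟨b + b - 1, ⟨b - 1, by omega⟩, by omega, by omega⟩
    · exact ⟨a, ha, by omega, by omega⟩
  obtain ⟨c, hc, n₀, hG⟩ := Grigoriev2001_mod2Degree_holds
  refine ⟨c / 16, by positivity, max (2 * n₀ + 4) (⌈8 / c⌉₊ + 4), ?_⟩
  intro n hn heven ε hε k hsos
  have hn₀ : 2 * n₀ + 4 ≤ n := le_trans (le_max_left _ _) hn
  have hn8 : ⌈8 / c⌉₊ + 4 ≤ n := le_trans (le_max_right _ _) hn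
  have hcn : 8 + 4 * c ≤ c * n := by
    have h8c : (8 / c : ℝ) ≤ (n : ℝ) - 4 := by
      have h1 : (8 / c : ℝ) ≤ ⌈8 / c⌉₊ := Nat.le_ceil _
      have h2 : ((⌈8 / c⌉₊ : ℕ) : ℝ) + 4 ≤ n := by exact_mod_cast hn8
      linarith
    have : c * (8 / c) = 8 := by field_simp
    nlinarith [mul_le_mul_of_nonneg_left h8c hc.le]
  -- an odd vertex set `U` with `|U| ∈ {n/2 - 1, n/2}`
  obtain ⟨m, hmodd, hmle, hmge⟩ := exists_odd_half heven (by omega)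
  obtain ⟨U, -, hUcard⟩ := Finset.exists_subset_card_eq
    (show m ≤ (Finset.univ : Finset (Fin n)).card by simp; omega)
  have hUodd : Odd U.card := hUcard ▸ hmodd
  obtain ⟨s, g, hg, hsum⟩ := hsos U hUodd
  -- lift the squares to polynomials of degree ≤ k
  choose Gp hGdeg hGeval using fun j => polLELift n k (g j) (hg j)
  set F : MvPolynomial (KnEdge n) ℝ := (cutPoly U + MvPolynomial.C ε) - ∑ j, Gp j * Gp j with hF
  have hFvan : ∀ M : Finset (Sym2 (Fin n)), IsPMOn Finset.univ M →
      MvPolynomial.eval (edgeIndicator M) F = 0 := by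
    intro M hM
    have hs := hsum ⟨M, hM⟩
    simp only [hF, map_sub, map_add, map_sum, map_mul, MvPolynomial.eval_C,
      eval_cutPoly_edgeIndicator U hM]
    rw [sub_eq_zero, hs]
    refine Finset.sum_congr rfl fun j _ => ?_
    rw [hGeval j ⟨M, hM⟩, pow_two]
  have hFdeg : F.totalDegree ≤ 2 * k + 1 := by
    rw [hF]
    refine le_trans (MvPolynomial.totalDegree_sub _ _) (max_le ?_ ?_)
    · refine le_trans (MvPolynomial.totalDegree_add _ _) (max_le ?_ ?_)
      · exact le_trans (totalDegree_cutPoly_le U) (by omega)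
      · rw [MvPolynomial.totalDegree_C]; omega
    · refine le_trans (MvPolynomial.totalDegree_finsetSum _ _) (Finset.sup_le fun j _ => ?_)
      refine le_trans (MvPolynomial.totalDegree_mul _ _) ?_
      have := hGdeg j
      omega
  -- effective derivation of the defect (BBCHPRRWZ Thm 4.9)
  obtain ⟨g', hg'deg, hg'sum⟩ := Mod2.matchingEffectiveDerivationV n heven F hFvan
  have hcert : HasSOSCertificate (Mod2.system n) (cutPoly U + MvPolynomial.C ε) (2 * k + 1) := by
    refine ⟨s, Gp, g', fun j => le_trans (hGdeg j) (by omega),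
      fun e => le_trans (hg'deg e) (by omega), ?_⟩
    rw [hg'sum, hF]
    abel
  -- restriction to `K_{|U|}` (BBCHPRRWZ §4.5, shifted) and Grigoriev
  have href : HasSOSRefutation (Mod2.system U.card) (2 * k + 1) :=
    oddCutRestrictionShift n heven U hUodd (by rw [hUcard]; exact hmle) ε hε (2 * k + 1) hcert
  have hGr := hG U.card (by rw [hUcard]; omega) (2 * k + 1) href
  rw [hUcard] at hGr
  push_cast at hGr
  have hmr : (n : ℝ) ≤ 2 * m + 2 := by exact_mod_cast hmge
  nlinarith [hmr, hGr, hcn, hc]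

/-! ### The counting endgame and R2-full -/

/-- **The counting endgame**, abstracted over how the degree-`k` sums of squares are produced: if for
every `k` with `4k + 2 ≤ n` and `[𝔖ₙ : G] · d² < 2^k` the `ε`-shifted odd-cut slacks are sums of squares
of degree `≤ k`, then `d ≥ 2^{αn}` (`α = min (1/16) (c/6)`, `k := ⌊log₂([𝔖ₙ:G]·d²)⌋ + 1`,
`(2^{αn})²·[𝔖ₙ:G] ≤ 2^{3αn} ≤ 2^{k−1} ≤ [𝔖ₙ:G]·d²`).
[cite: BraunEtAl2016, Thm. 4.10 (proof, pp. 9–10, "d < √(n choose k) − 1 … 2k − 1 = Ω(m) = Ω(n)")] -/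
theorem two_pow_le_of_sos : ∃ α : ℝ, 0 < α ∧ ∃ n₀ : ℕ, ∀ ε : ℝ, 0 ≤ ε → ε < 1 → ∀ n : ℕ, n₀ ≤ n →
    Even n → ∀ G : Subgroup (Equiv.Perm (Fin n)), (G.index : ℝ) < (2 : ℝ) ^ (α * n) → ∀ d : ℕ,
      (∀ k : ℕ, 4 * k + 2 ≤ n → G.index * d ^ 2 < 2 ^ k →
        ∀ U : Finset (Fin n), Odd U.card → ∃ (s : ℕ) (g : Fin s → (PMSol n → ℝ)),
          (∀ j, g j ∈ polLE n k) ∧ ∀ M : PMSol n, pmSlack U M.1 + ε = ∑ j, (g j M) ^ 2) →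
      (2 : ℝ) ^ (α * n) ≤ d := by
  classical
  obtain ⟨c, hc, n₁, hB⟩ := thetaRank_linear_shift
  refine ⟨min (1 / 16) (c / 6), lt_min (by norm_num) (by positivity), max n₁ (max 20 ⌈2 / c⌉₊), ?_⟩
  intro ε hε0 hε1 n hn heven G hGidx d hT
  have hn₁ : n₁ ≤ n := le_trans (le_max_left _ _) hn
  have h20 : 20 ≤ n := le_trans (le_trans (le_max_left _ _) (le_max_right _ _)) hn
  have hNc : ⌈2 / c⌉₊ ≤ n := le_trans (le_trans (le_max_right _ _) (le_max_right _ _)) hn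
  have hcn : 2 ≤ c * n := by
    have h2c : (2 / c : ℝ) ≤ n := le_trans (Nat.le_ceil _) (by exact_mod_cast hNc)
    have : c * (2 / c) = 2 := by field_simp
    nlinarith [mul_le_mul_of_nonneg_left h2c hc.le]
  set α : ℝ := min (1 / 16) (c / 6) with hα
  have hα16 : α ≤ 1 / 16 := min_le_left _ _
  have hαc : α ≤ c / 6 := min_le_right _ _
  have hαpos : 0 < α := lt_min (by norm_num) (by positivity)
  have hn0 : (0 : ℝ) ≤ n := Nat.cast_nonneg n
  have h20' : (20 : ℝ) ≤ n := by exact_mod_cast h20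
  -- the index is a positive natural number
  set I : ℕ := G.index with hI
  have hIpos : 0 < I := Nat.pos_of_ne_zero G.index_ne_zero_of_finite
  have hIpos' : (0 : ℝ) < I := by exact_mod_cast hIpos
  set L : ℕ := Nat.log 2 (I * d ^ 2) with hL
  have hdlt : I * d ^ 2 < 2 ^ (L + 1) := Nat.lt_pow_succ_log_self (by norm_num) _
  have key : 3 * (α * n) ≤ (L : ℝ) ∧ 1 ≤ d := by
    by_cases hk : 4 * (L + 1) + 2 ≤ n
    · have hsos := hT (L + 1) hk hdlt
      have hB' : c * n ≤ ((L + 1 : ℕ) : ℝ) := hB n hn₁ heven ε hε1 (L + 1) hsos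
      push_cast at hB'
      refine ⟨?_, ?_⟩
      · nlinarith [mul_le_mul_of_nonneg_right hαc hn0]
      · by_contra hd0
        push Not at hd0
        have hd : d = 0 := by omega
        have hL0 : L = 0 := by rw [hL, hd]; simp
        rw [hL0] at hB'
        push_cast at hB'
        linarith
    · push Not at hk
      have hkr : (n : ℝ) ≤ 4 * L + 5 := by exact_mod_cast (by omega : n ≤ 4 * L + 5)
      refine ⟨?_, ?_⟩
      · nlinarith [mul_le_mul_of_nonneg_right hα16 hn0]
      · by_contra hd0
        push Not at hd0
        have hd : d = 0 := by omega
        have hL0 : L = 0 := by rw [hL, hd]; simp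
        omega
  obtain ⟨hαL, hd1⟩ := key
  have hpow : (2 : ℝ) ^ (L : ℝ) ≤ (I : ℝ) * (d : ℝ) ^ 2 := by
    rw [Real.rpow_natCast]
    have := Nat.pow_log_le_self 2 (by positivity : I * d ^ 2 ≠ 0)
    exact_mod_cast this
  have h3αn : (2 : ℝ) ^ (3 * (α * n)) ≤ (2 : ℝ) ^ (L : ℝ) :=
    Real.rpow_le_rpow_of_exponent_le (by norm_num) hαL
  -- `(2^{αn})² · I ≤ 2^{2αn} · 2^{αn} = 2^{3αn} ≤ 2^L ≤ I · d²`
  have hx : 0 < (2 : ℝ) ^ (α * n) := by positivity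
  have hsqI : ((2 : ℝ) ^ (α * n)) ^ 2 * I ≤ (I : ℝ) * (d : ℝ) ^ 2 := by
    have h1 : ((2 : ℝ) ^ (α * n)) ^ 2 * I ≤ ((2 : ℝ) ^ (α * n)) ^ 2 * (2 : ℝ) ^ (α * n) :=
      mul_le_mul_of_nonneg_left hGidx.le (by positivity)
    have h2 : ((2 : ℝ) ^ (α * n)) ^ 2 * (2 : ℝ) ^ (α * n) = (2 : ℝ) ^ (3 * (α * n)) := by
      rw [pow_two, ← Real.rpow_add (by norm_num), ← Real.rpow_add (by norm_num)]
      ring_nf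
    rw [h2] at h1
    exact h1.trans (h3αn.trans hpow)
  have hsq : ((2 : ℝ) ^ (α * n)) ^ 2 ≤ (d : ℝ) ^ 2 := by
    have := hsqI
    rw [mul_comm (I : ℝ) _] at this
    exact le_of_mul_le_mul_right this hIpos'
  have hdnn : (0 : ℝ) ≤ d := Nat.cast_nonneg d
  exact (pow_le_pow_iff_left₀ hx.le hdnn two_ne_zero).1 hsq

/-- **R2-full: subgroup-equivariant psd factorizations of the matching polytope have size `2^{Ω(n)}`,
uniformly in the shift `0 ≤ ε < 1` and over all subgroups of index `< 2^{αn}`.** There are `α > 0`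
and `n₀` such that for every `0 ≤ ε < 1`, every even `n ≥ n₀`, every subgroup `G ≤ 𝔖ₙ` with
`[𝔖ₙ : G] < 2^{αn}` (e.g. `A_n`) and every `d`: a `G`-equivariant psd factorization (arbitrary real
representation `ρ : G → GL_d(ℝ)` on the matching side) of the `ε`-shifted odd-cut slack matrix of
`P_PM(K_n)` has `d ≥ 2^{αn}`. IN PRINT: Braun et al. Thm. 4.10 = the case `G = A_n`, `ρ` by
coordinate permutations (see `BraunEtAl2016_symmetricSDP_matching_holds`); Fawzi–Saunderson–Parrilo
Thm. 1/Thm. 4 = the structure theorem for arbitrary `G`, `ρ` (no matching bound). The uniform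
subgroup / arbitrary-`ρ` form is the cell's R2-full (same engine; not found stated in print — cell
presearch 2026-08-25), proved here; `matchingEquivariantPsdBound` is the case `ε = 0`, `G = 𝔖ₙ` (via
`HasEquivariantPsdFactorization.hasSubgroupEquivariantPsdFactorization_top`). Statement = the cell's
typed `MatchingSubgroupEquivariantPsdBound` (HOME/pnp-psdrank-p2/Sketch-v4-R2full.lean, verbatim).
[cite: BraunEtAl2016, Thm. 4.10 (p. 9)] [cite: FawziSaundersonParrilo2013, Thm. 1 (p. 7) and Thm. 4 (p. 10)] -/
theorem matchingSubgroupEquivariantPsdBound :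
    ∃ α : ℝ, 0 < α ∧ ∃ n₀ : ℕ, ∀ ε : ℝ, 0 ≤ ε → ε < 1 → ∀ n : ℕ, n₀ ≤ n → Even n →
      ∀ G : Subgroup (Equiv.Perm (Fin n)), (G.index : ℝ) < (2 : ℝ) ^ (α * n) →
        ∀ d : ℕ, HasSubgroupEquivariantPsdFactorization n d G ε → (2 : ℝ) ^ (α * n) ≤ d := by
  obtain ⟨α, hα, n₀, h⟩ := two_pow_le_of_sos
  exact ⟨α, hα, n₀, fun ε hε0 hε1 n hn heven G hG d hfac => h ε hε0 hε1 n hn heven G hG d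
    fun k hk hd => sos_of_subgroupEquivariantPsdFactorization n k d G ε heven hk hd hfac⟩

/-- **R2-full, affine form** (the version the SDP bridge consumes): the same bound for affine
`G`-equivariant psd factorizations `pmSlack U M + ε = tr(A(M) B(U)) + μ(U)`, `μ ≥ 0`.
[cite: BraunEtAl2016, Lemma 2.3 (p. 5) and Thm. 4.10 (p. 9)] -/
theorem subgroupEquivariantPsdBoundAff : ∃ α : ℝ, 0 < α ∧ ∃ n₀ : ℕ, ∀ ε : ℝ, 0 ≤ ε → ε < 1 →
    ∀ n : ℕ, n₀ ≤ n → Even n → ∀ G : Subgroup (Equiv.Perm (Fin n)), (G.index : ℝ) < (2 : ℝ) ^ (α * n) →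
      ∀ (d : ℕ) (ρ : G →* GL (Fin d) ℝ) (A : Finset (Sym2 (Fin n)) → Matrix (Fin d) (Fin d) ℝ)
        (B : Finset (Fin n) → Matrix (Fin d) (Fin d) ℝ) (μ : Finset (Fin n) → ℝ),
        IsSubgroupEquivariantPsdFactorizationAff n d G ε ρ A B μ → (2 : ℝ) ^ (α * n) ≤ d := by
  obtain ⟨α, hα, n₀, h⟩ := two_pow_le_of_sos
  exact ⟨α, hα, n₀, fun ε hε0 hε1 n hn heven G hG d ρ A B μ hfac => h ε hε0 hε1 n hn heven G hG d
    fun k hk hd => sos_of_subgroupEquivariantPsdFactorizationAff n k d G ε ρ A B μ heven hk hd hfac⟩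

/-! ### The bridge: Braun et al. Theorem 4.10 discharged -/

/-- **Braun–Brown-Cohen–Huq–Pokutta–Raghavendra–Roy–Weitz–Zink, Theorem 4.10 (Main) — PROVED**:
discharge of the named fact `BraunEtAl2016_symmetricSDP_matching` (`SymmetricSDPMatching.lean`):
there is `α > 0` such that for all sufficiently large even `n` and every `0 ≤ ε < 1`, every
`A_n`-coordinate-symmetric SDP formulation (Def. 2.2) of the perfect matching problem with the
`ε`-shifted guarantee `C̃(f) = max f + ε/2` has size `d ≥ 2^{αn}`. Proof: by the SDP factorization
theorem (Lemma 2.3; tree `SDPFormulation.exists_posSemidef_slack`) and the slack identity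
`2(C̃(f_{E[U]}) − f_{E[U]}(M)) = |δ(U) ∩ M| − 1 + ε` (§4.5, p. 9; tree `two_mul_pmSlack_inner_eq`) the
formulation is an affine `A_n`-equivariant psd factorization of size `d` of the `ε`-shifted odd-cut slack
(`A(M) = X^M`, `B(U) = 2U^{f_{E[U]}}`, `μ(U) = 2μ_f`, representation `σ ↦ P_{ρ(σ)⁻¹}` via
`permAct_eq_permMatrix_mul_mul_transpose`), and `[𝔖ₙ : A_n] = 2 < 2^{αn}`; conclude with
`subgroupEquivariantPsdBoundAff`. [cite: BraunEtAl2016, Thm. 4.10 (p. 9, proof pp. 9–10) and Lemma 2.3 (p. 5)] -/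
theorem BraunEtAl2016_symmetricSDP_matching_holds : BraunEtAl2016_symmetricSDP_matching := by
  classical
  obtain ⟨α, hα, n₀, h⟩ := subgroupEquivariantPsdBoundAff
  refine ⟨α, hα, max n₀ (max 2 (⌈2 / α⌉₊)), ?_⟩
  intro n hn heven ε hε0 hε1 d E ρ hE
  have hn₀ : n₀ ≤ n := le_trans (le_max_left _ _) hn
  have h2 : 2 ≤ n := le_trans (le_trans (le_max_left _ _) (le_max_right _ _)) hn
  have hNα : ⌈2 / α⌉₊ ≤ n := le_trans (le_trans (le_max_right _ _) (le_max_right _ _)) hn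
  haveI : Nontrivial (Fin n) := Fin.nontrivial_iff_two_le.mpr h2
  have hidx : ((alternatingGroup (Fin n)).index : ℝ) < (2 : ℝ) ^ (α * n) := by
    rw [alternatingGroup.index_eq_two]
    have hαn : (1 : ℝ) < α * n := by
      have h2c : (2 / α : ℝ) ≤ n := le_trans (Nat.le_ceil _) (by exact_mod_cast hNα)
      have : α * (2 / α) = 2 := by field_simp
      nlinarith [mul_le_mul_of_nonneg_left h2c hα.le]
    calc ((2 : ℕ) : ℝ) = (2 : ℝ) ^ (1 : ℝ) := by norm_num
      _ < (2 : ℝ) ^ (α * n) := Real.rpow_lt_rpow_of_exponent_lt (by norm_num) hαn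
  -- the factorization theorem, objective by objective
  let F : Finset (Fin n) → EdgeSet n := fun U =>
    ⟨U.sym2.filter fun e => ¬e.IsDiag, fun e he => (mem_filter.1 he).2⟩
  choose Uf hUf μf hμf hslack using fun U : Finset (Fin n) =>
    E.exists_posSemidef_slack (pmProblem_sound ε (F U))
  refine h ε hε0 hε1 n hn₀ heven _ hidx d
    ((Matrix.permMatrixHom (n := Fin d) (R := ℝ)).toHomUnits.comp ρ)
    (fun M => if hM : IsPMOn univ M then E.X ⟨M, hM⟩ else 0) (fun U => (2 : ℝ) • Uf U)
    (fun U => 2 * μf U) ⟨?_, ?_, ?_, ?_, ?_⟩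
  · intro M hM
    dsimp only
    rw [dif_pos hM]
    exact E.posSemidef_X _
  · intro U _
    exact (hUf U).smul zero_le_two
  · intro U _
    have := hμf U
    positivity
  · intro U M hU hM
    dsimp only
    rw [dif_pos hM]
    have hid := two_mul_pmSlack_inner_eq ε ⟨U, hU⟩ ⟨M, hM⟩ (F U) rfl
    rw [hslack U ⟨M, hM⟩] at hid
    have hps : pmOddCutSlack n ⟨U, hU⟩ ⟨M, hM⟩ = pmSlack U M := by
      rw [pmOddCutSlack_apply, cc_eq_card_filter]
      rfl
    rw [← hps, ← hid, Matrix.mul_smul, trace_smul, smul_eq_mul, Matrix.trace_mul_comm]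
    ring
  · intro σ M hM
    have hσM : IsPMOn univ (permEdges (σ : Equiv.Perm (Fin n)) M) := isPMOn_univ_image_map _ hM
    dsimp only
    rw [dif_pos hσM, dif_pos hM]
    have h1 : E.X ⟨permEdges (σ : Equiv.Perm (Fin n)) M, hσM⟩ = permAct (ρ σ) (E.X ⟨M, hM⟩) :=
      hE.X_smul σ ⟨M, hM⟩
    rw [h1, MonoidHom.comp_apply, MonoidHom.coe_toHomUnits, Matrix.permMatrixHom_apply]
    exact permAct_eq_permMatrix_mul_mul_transpose (ρ σ) _

end Literature.Combinatorics.Optimization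

end
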